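import Mathlib
import Literature.NumberTheory.LFunctions.Zhang2022.SkeletonPropositions
import HarnessLib

/-!
# Zhang (2022), rescue bed (D-0124 (3)): the §2 objects over an explicit SCALE, with regression to
# the skeleton at Zhang's parameters

Topic `Literature/NumberTheory/LFunctions/Zhang2022` (Landau–Siegel audit tree; verdict-neutral).
Y. Zhang, *Discrete mean estimates and the Landau–Siegel zero*, arXiv:2211.02515v1 (2022)
[Zhang2022LandauSiegel] — **an unrefereed manuscript under adjudication; nothing in this file asserts or
denies any of its claims, and nothing here is a claim about Landau–Siegel zeros.**

Purpose (LS rescue protocol, «genuine bed»). The skeleton (`SkeletonSetting`, `SkeletonObjects`) defines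
the objects of §2 — the shifts `β_j`, the weight `ω`, `𝔠*(ρ,ψ)`, the Dirichlet polynomials `H₁ⱼ, H₁, H₂,
J₁, J₂`, the factor `Z(s,ψχ)` and the discrete means `Ξ₁*, Ξ₁, Ξ_J, Ξ₁₁, Ξ₁₂, Ξ₁₃, ΣΣ𝔠*|J₁ − ZJ̄₂|²ω` — as
functions of the modulus `D` ALONE, through the parameter maps `𝓛 = log D`, `P = exp 𝓛⁹` (2.6),
`t₀ = 𝓛⁵¹⁹` (2.8), `𝓛₁ = 𝓛⁴⁰⁵`, `𝓛₂ = 𝓛⁴⁰⁰` (2.15), `P₁ = P^{0.504}`, `P₂ = P^{0.5}T^{−10}`, `P₃ = P^{0.498}`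
(2.21), `α̃` (2.30), and over the family `Ψ` of primitive `ψ (mod p)`, `p ∼ P`. At every modulus these
parameters are far outside computation (`D = 10`: `P = e^{1.8·10³}`, `t₀ ≈ 10^{188}`). A numerical test bed
therefore evaluates THE SAME EXPRESSIONS at an explicit, reachable parameter tuple and over an explicit
finite list of characters `ψ (mod p)` and of zeros `ρ` of `L(s,ψ)`. This file gives those evaluations a
typed referent:

* `Scale` — the tuple `(𝓛, P, t₀, 𝓛₁, 𝓛₂, P₁, P₂, P₃, α̃)` as free real numbers, and `Scale.zhang D` — the
  manuscript's tuple at modulus `D` (the skeleton's parameter maps);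
* every object above re-defined over `S : Scale`, for an ARBITRARY character `ψ` to an arbitrary modulus
  `p` (no prime window) and the real character `χ (mod D)`: `alpha`, `s0`, `beta1 … beta7`, `omegaW`,
  `vk1 vk2 vk3`, `pc`, `H11 H12 H13 H1 H2`, `J1 J2`, `psiChi`, `Zpc`, `cstar`, the zero box `zeroBox`;
* the per-zero SUMMANDS of the discrete means (`xiStar1Term`, `xi1Term`, `xiJTerm`, `xi11Term`, `xi12Term`,
  `xi13Term`, `xi3sqTerm`) and their sums over an explicit finite set of zeros (`xiStar1Sum`, …, `xi3sqSum`),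
  plus the window normaliser `frakPOf W = Σ_{p ∈ W} p`;
* REGRESSION THEOREMS (`…_zhang`): at `S = Scale.zhang D` and a member `x` of the skeleton's family `Ψ`,
  each object IS the skeleton's (definitional equalities), and each skeleton mean is the sum of the bed
  summands over the skeleton's index set (`Skeleton.xi11 c' χ = Σ_{(ψ,ρ) ∈ idx χ} xi11Term (Scale.zhang D) …`,
  etc.). So a bed row «`Ξ₁₁` at scale `S`, characters `F`, zeros `Z`» names an object that is PROVABLY the
  manuscript's `Ξ₁₁` when `(S, F, Z)` are the manuscript's.

Design notes. (1) The design exponents/shift multipliers/coefficients are the PRINTED ones (`θ₀` of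
`Repair.Theta`: `k = 3/2, 5/2, 3/2`, `ι₂, ι₃, ι₄` of (2.26), the tent (2.28)); the lengths `P₁, P₂, P₃` are
free fields of the scale (so «mollifier lengths / ranges» can be varied by the bed), the exponents are not
re-derived from them. (2) `Y`, `M = YL` are the skeleton's (`Skeleton.Yroot`, `Skeleton.Mfun`, generic in
the modulus). (3) The subfamily `Ψ₁` ((3.4)–(3.6)) and the prime window are NOT re-scaled here: a bed
declares its finite family explicitly; `frakPOf` normalises by any finite set of moduli. (4) No `instance`,
no notation; the product modulus `D·p` is handled with an in-term `NeZero` witness. Pure definitions and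
`rfl`-regressions; no analytic content. (5) (rev 2) Character-side Tier-G1 quantities: `AssumptionAWith A D χ`
((A) with a real exponent; `assumptionA_iff_with` at `A = 2022`, `assumptionAWith_anti`) and the bed axis
`aExponent D χ = −log‖L(1,χ)‖/log log D` with `assumptionAWith_iff_lt_aExponent` / `assumptionA_iff_lt_aExponent`.

## References

* Y. Zhang, arXiv:2211.02515v1 (2022), §2 (2.6)–(2.33), §8 (8.3)–(8.6), §11 (11.1).
  [cite: Zhang2022LandauSiegel, §§2, 8, 11]
-/

noncomputable section

open Complex Real ComplexConjugate

namespace Literature.NumberTheory.LFunctions.Zhang2022.Repair.Bed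

/-! ## The scale -/

/-- **A bed scale**: the parameter tuple of §2 as free real numbers — `L` plays `𝓛 = log D` (2.1) (it
enters `β₁, β₂, β₃` (2.13)), `P` (2.6) (`α = π/log P` (2.10), `J₁` (2.29)), `t0` (2.8) (`s₀`, `ω`, the zero
box (2.14)), `L1 = 𝓛₁` (2.14), `L2 = 𝓛₂` (2.15), the lengths `P1, P2, P3` (2.21) of `H₁₁, H₁₂, H₁₃`, and
`aT = α̃` (2.30) (the shift of `J₂`). [cite: Zhang2022LandauSiegel, §2 (2.1)–(2.30)] -/
structure Scale where
  /-- plays `𝓛 = log D` (2.1) -/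
  L : ℝ
  /-- plays `P` (2.6) -/
  P : ℝ
  /-- plays `t₀` (2.8) -/
  t0 : ℝ
  /-- plays `𝓛₁` (2.14) -/
  L1 : ℝ
  /-- plays `𝓛₂` (2.15) -/
  L2 : ℝ
  /-- plays `P₁` (2.21) -/
  P1 : ℝ
  /-- plays `P₂` (2.21) -/
  P2 : ℝ
  /-- plays `P₃` (2.21) -/
  P3 : ℝ
  /-- plays `α̃ = log(Dt₀)/log P` (2.30) -/
  aT : ℝ

/-- **The manuscript's scale at modulus `D`**: `(log D, exp 𝓛⁹, 𝓛⁵¹⁹, 𝓛⁴⁰⁵, 𝓛⁴⁰⁰, P^{0.504}, P^{0.5}T^{−10},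
P^{0.498}, log(Dt₀)/log P)` — the skeleton's parameter maps. [cite: Zhang2022LandauSiegel, §2 (2.1)–(2.30)] -/
def Scale.zhang (D : ℕ) : Scale where
  L := Skeleton.ell D
  P := Skeleton.bigP D
  t0 := Skeleton.t0 D
  L1 := Skeleton.ell1 D
  L2 := Skeleton.ell2 D
  P1 := Skeleton.P1 D
  P2 := Skeleton.P2 D
  P3 := Skeleton.P3 D
  aT := Skeleton.alphaTilde D

section Objects

variable (S : Scale)

/-! ## Parameters derived from the scale -/

/-- `α = π / log P` (2.10) at scale `S`. [cite: Zhang2022LandauSiegel, §2 (2.10)] -/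
def alpha : ℝ := Real.pi / Real.log S.P

/-- `s₀ = 1/2 + 2πit₀` (2.8) at scale `S` (the tree's `SmoothWeight.s0`). [cite: Zhang2022LandauSiegel, §2 (2.8)] -/
def s0 : ℂ := SmoothWeight.s0 S.t0

/-- `β₁ = iα(1 − 5c′α𝓛)` (2.13) at scale `S`. [cite: Zhang2022LandauSiegel, §2 (2.13)] -/
def beta1 (c' : ℝ) : ℂ := I * (alpha S : ℂ) * (1 - 5 * c' * alpha S * S.L : ℝ)

/-- `β₂ = 2iα(1 + c′α𝓛)` (2.13) at scale `S`. [cite: Zhang2022LandauSiegel, §2 (2.13)] -/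
def beta2 (c' : ℝ) : ℂ := 2 * I * (alpha S : ℂ) * (1 + c' * alpha S * S.L : ℝ)

/-- `β₃ = 3iα(1 − c′α𝓛)` (2.13) at scale `S`. [cite: Zhang2022LandauSiegel, §2 (2.13)] -/
def beta3 (c' : ℝ) : ℂ := 3 * I * (alpha S : ℂ) * (1 - c' * alpha S * S.L : ℝ)

/-- `β₆ = 3iα/2` (2.22) at scale `S`. [cite: Zhang2022LandauSiegel, §2 (2.22)] -/
def beta6 : ℂ := 3 * I * (alpha S : ℂ) / 2

/-- `β₇ = 5iα/2` (2.22) at scale `S`. [cite: Zhang2022LandauSiegel, §2 (2.22)] -/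
def beta7 : ℂ := 5 * I * (alpha S : ℂ) / 2

/-- `ω(s) = (√π/𝓛₂)exp{(s − s₀)²/(4𝓛₂²)}` (2.15) at scale `S` (the tree's `SmoothWeight.omega`).
[cite: Zhang2022LandauSiegel, §2 (2.15)] -/
def omegaW (s : ℂ) : ℂ := SmoothWeight.omega S.L2 S.t0 s

/-! ## The Dirichlet polynomials (2.23)–(2.30), (8.6) at scale `S` -/

/-- `ϰ₁(n) = (1 − log n/log P₁)(P₁/n)^{β₆}` for `n < P₁`, else `0` (8.6), at scale `S`.
[cite: Zhang2022LandauSiegel, §8 (8.6)] -/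
def vk1 (n : ℕ) : ℂ :=
  if (n : ℝ) < S.P1 then (1 - Real.log n / Real.log S.P1 : ℝ) * ((S.P1 / n : ℝ) : ℂ) ^ beta6 S else 0

/-- `ϰ₂(n) = (1 − log n/log P₂)(P₂/n)^{β₇}` for `n < P₂`, else `0` (8.6), at scale `S`.
[cite: Zhang2022LandauSiegel, §8 (8.6)] -/
def vk2 (n : ℕ) : ℂ :=
  if (n : ℝ) < S.P2 then (1 - Real.log n / Real.log S.P2 : ℝ) * ((S.P2 / n : ℝ) : ℂ) ^ beta7 S else 0

/-- `ϰ₃(n) = (1 − log n/log P₃)(P₃/n)^{β₆}` for `n < P₃`, else `0` (8.6), at scale `S`.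
[cite: Zhang2022LandauSiegel, §8 (8.6)] -/
def vk3 (n : ℕ) : ℂ :=
  if (n : ℝ) < S.P3 then (1 - Real.log n / Real.log S.P3 : ℝ) * ((S.P3 / n : ℝ) : ℂ) ^ beta6 S else 0

variable {D : ℕ} (χ : DirichletCharacter ℂ D) {p : ℕ} (ψ : DirichletCharacter ℂ p)

/-- The coefficient `ψχ(n) = ψ(n)χ(n)` for an arbitrary character `ψ (mod p)`.
[cite: Zhang2022LandauSiegel, §2 (2.23)] -/
def pc (n : ℕ) : ℂ := ψ (n : ZMod p) * χ (n : ZMod D)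

/-- `H₁₁(s,ψ) = Σ_{n<P₁} ϰ₁(n)ψχ(n)n^{−s}` (2.23)/(8.6) at scale `S`. [cite: Zhang2022LandauSiegel, §2 (2.23)] -/
def H11 (s : ℂ) : ℂ := ∑ n ∈ Finset.Ico 1 ⌈S.P1⌉₊, vk1 S n * pc χ ψ n * (n : ℂ) ^ (-s)

/-- `H₁₂(s,ψ) = Σ_{n<P₂} ϰ₂(n)ψχ(n)n^{−s}` (2.24) at scale `S`. [cite: Zhang2022LandauSiegel, §2 (2.24)] -/
def H12 (s : ℂ) : ℂ := ∑ n ∈ Finset.Ico 1 ⌈S.P2⌉₊, vk2 S n * pc χ ψ n * (n : ℂ) ^ (-s)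

/-- `H₁₃(s,ψ) = Σ_{n<P₃} ϰ₃(n)ψχ(n)n^{−s}` (2.25) at scale `S`. [cite: Zhang2022LandauSiegel, §2 (2.25)] -/
def H13 (s : ℂ) : ℂ := ∑ n ∈ Finset.Ico 1 ⌈S.P3⌉₊, vk3 S n * pc χ ψ n * (n : ℂ) ^ (-s)

/-- `H₁ = H₁₁ + ι₂H₁₂` (2.27) at scale `S` (`ι₂` of (2.26)). [cite: Zhang2022LandauSiegel, §2 (2.27)] -/
def H1 (s : ℂ) : ℂ := H11 S χ ψ s + iota2 * H12 S χ ψ s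

/-- `H₂ = ῑ₃H₁₃ + ῑ₄H₁₂` (2.27) at scale `S` (`ι₃, ι₄` of (2.26)). [cite: Zhang2022LandauSiegel, §2 (2.27)] -/
def H2 (s : ℂ) : ℂ := conj iota3 * H13 S χ ψ s + conj iota4 * H12 S χ ψ s

/-- `J₁(s,ψ) = Σ_n ψχ(n)n^{−s}f̃(log n/log P)` (2.29) at scale `S` (the tent `f̃` of (2.28) is scale-free).
[cite: Zhang2022LandauSiegel, §2 (2.29)] -/
def J1 (s : ℂ) : ℂ :=
  ∑ᶠ n : ℕ, pc χ ψ n * (n : ℂ) ^ (-s) * (Skeleton.ftilde (Real.log n / Real.log S.P) : ℂ)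

/-- `J₂(s,ψ) = Σ_n ψχ(n)n^{−s}f̃(log n/log P + 0.004 − α̃)` (2.30) at scale `S`.
[cite: Zhang2022LandauSiegel, §2 (2.30)] -/
def J2 (s : ℂ) : ℂ :=
  ∑ᶠ n : ℕ, pc χ ψ n * (n : ℂ) ^ (-s) * (Skeleton.ftilde (Real.log n / Real.log S.P + 0.004 - S.aT) : ℂ)

variable [NeZero D] [NeZero p]

/-- The product character `ψχ (mod Dp)` for an arbitrary `ψ (mod p)` (§4 p. 8).
[cite: Zhang2022LandauSiegel, §4 p. 8] -/
def psiChi : DirichletCharacter ℂ (D * p) :=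
  DirichletCharacter.changeLevel (dvd_mul_right D p) χ * DirichletCharacter.changeLevel (dvd_mul_left p D) ψ

/-- `Z(s,ψχ)` (2.2) for the product character (the tree's `GammaFactor.Zfac`; the modulus `Dp` is non-zero
because `D` and `p` are). [cite: Zhang2022LandauSiegel, §2 (2.2)] -/
def Zpc (s : ℂ) : ℂ :=
  haveI : NeZero (D * p) := ⟨mul_ne_zero (NeZero.ne D) (NeZero.ne p)⟩
  GammaFactor.Zfac (psiChi χ ψ) s

/-- **`𝔠*(ρ,ψ) = −iM(ρ+β₁)M(ρ+β₂)M(ρ+β₃)/M′(ρ)`** (§2 p. 5) at scale `S` (`M = YL` the skeleton's `Mfun`).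
[cite: Zhang2022LandauSiegel, §2 p. 5] -/
def cstar (c' : ℝ) (ρ : ℂ) : ℂ :=
  -I * Skeleton.Mfun ψ (ρ + beta1 S c') * Skeleton.Mfun ψ (ρ + beta2 S c') * Skeleton.Mfun ψ (ρ + beta3 S c')
    / deriv (Skeleton.Mfun ψ) ρ

/-- **The zero box** `𝔷(ψ)` (2.14) at scale `S`: zeros of `L(s,ψ)` with `|σ − 1/2| < 1/2`,
`|t − 2πt₀| < 𝓛₁` (a bed's explicit zero list is to be a subset). [cite: Zhang2022LandauSiegel, §2 (2.14)] -/
def zeroBox : Set ℂ :=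
  {ρ | |ρ.re - 1 / 2| < 1 / 2 ∧ |ρ.im - 2 * π * S.t0| < S.L1 ∧ ψ.LFunction ρ = 0}

/-- `𝔓` over an explicit finite set of moduli: `Σ_{p ∈ W} p` ((2.9) with the window replaced by `W`).
[cite: Zhang2022LandauSiegel, §2 (2.9)] -/
def frakPOf (W : Finset ℕ) : ℝ := ∑ q ∈ W, (q : ℝ)

/-! ## The per-zero summands of the discrete means and their sums over an explicit zero set -/

/-- Summand of `Ξ₁*` (2.17): `𝔠*(ρ,ψ)(H₁J̄₁ + H̄₂J₂)(ρ,ψ)ω(ρ)`. [cite: Zhang2022LandauSiegel, §2 (2.17)] -/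
def xiStar1Term (c' : ℝ) (ρ : ℂ) : ℂ :=
  cstar S ψ c' ρ * (H1 S χ ψ ρ * conj (J1 S χ ψ ρ) + conj (H2 S χ ψ ρ) * J2 S χ ψ ρ) * omegaW S ρ

/-- Summand of `Ξ₁` (2.32)/(8.1): `Re 𝔠*·|H₁ + ZH̄₂|²·Re ω`. [cite: Zhang2022LandauSiegel, §2 (2.32)] -/
def xi1Term (c' : ℝ) (ρ : ℂ) : ℝ :=
  (cstar S ψ c' ρ).re * ‖H1 S χ ψ ρ + Zpc χ ψ ρ * conj (H2 S χ ψ ρ)‖ ^ 2 * (omegaW S ρ).re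

/-- Summand of `Ξ_J` (2.33): `Re 𝔠*·|J₁|²·Re ω`. [cite: Zhang2022LandauSiegel, §2 (2.33)] -/
def xiJTerm (c' : ℝ) (ρ : ℂ) : ℝ := (cstar S ψ c' ρ).re * ‖J1 S χ ψ ρ‖ ^ 2 * (omegaW S ρ).re

/-- Summand of `Ξ₁₁` (8.3): `Re 𝔠*·|H₁|²·Re ω`. [cite: Zhang2022LandauSiegel, §8 (8.3)] -/
def xi11Term (c' : ℝ) (ρ : ℂ) : ℝ := (cstar S ψ c' ρ).re * ‖H1 S χ ψ ρ‖ ^ 2 * (omegaW S ρ).re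

/-- Summand of `Ξ₁₂` (8.4): `Re 𝔠*·|H₂|²·Re ω`. [cite: Zhang2022LandauSiegel, §8 (8.4)] -/
def xi12Term (c' : ℝ) (ρ : ℂ) : ℝ := (cstar S ψ c' ρ).re * ‖H2 S χ ψ ρ‖ ^ 2 * (omegaW S ρ).re

/-- Summand of `Ξ₁₃` (8.5): `𝔠*·Z(ρ,ψχ)⁻¹·H₁H₂·ω`. [cite: Zhang2022LandauSiegel, §8 (8.5)] -/
def xi13Term (c' : ℝ) (ρ : ℂ) : ℂ :=
  cstar S ψ c' ρ * (Zpc χ ψ ρ)⁻¹ * (H1 S χ ψ ρ * H2 S χ ψ ρ) * omegaW S ρ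

/-- Summand of the (11.1) mean square: `Re 𝔠*·|J₁ − ZJ̄₂|²·Re ω`. [cite: Zhang2022LandauSiegel, §11 (11.1)] -/
def xi3sqTerm (c' : ℝ) (ρ : ℂ) : ℝ :=
  (cstar S ψ c' ρ).re * ‖J1 S χ ψ ρ - Zpc χ ψ ρ * conj (J2 S χ ψ ρ)‖ ^ 2 * (omegaW S ρ).re

/-- `Ξ₁*` restricted to one character and an explicit finite zero set `Z`. [cite: Zhang2022LandauSiegel, §2 (2.17)] -/
def xiStar1Sum (c' : ℝ) (Z : Finset ℂ) : ℂ := ∑ ρ ∈ Z, xiStar1Term S χ ψ c' ρ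
/-- `Ξ₁` restricted to one character and an explicit finite zero set. [cite: Zhang2022LandauSiegel, §2 (2.32)] -/
def xi1Sum (c' : ℝ) (Z : Finset ℂ) : ℝ := ∑ ρ ∈ Z, xi1Term S χ ψ c' ρ
/-- `Ξ_J` restricted to one character and an explicit finite zero set. [cite: Zhang2022LandauSiegel, §2 (2.33)] -/
def xiJSum (c' : ℝ) (Z : Finset ℂ) : ℝ := ∑ ρ ∈ Z, xiJTerm S χ ψ c' ρ
/-- `Ξ₁₁` restricted to one character and an explicit finite zero set. [cite: Zhang2022LandauSiegel, §8 (8.3)] -/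
def xi11Sum (c' : ℝ) (Z : Finset ℂ) : ℝ := ∑ ρ ∈ Z, xi11Term S χ ψ c' ρ
/-- `Ξ₁₂` restricted to one character and an explicit finite zero set. [cite: Zhang2022LandauSiegel, §8 (8.4)] -/
def xi12Sum (c' : ℝ) (Z : Finset ℂ) : ℝ := ∑ ρ ∈ Z, xi12Term S χ ψ c' ρ
/-- `Ξ₁₃` restricted to one character and an explicit finite zero set. [cite: Zhang2022LandauSiegel, §8 (8.5)] -/
def xi13Sum (c' : ℝ) (Z : Finset ℂ) : ℂ := ∑ ρ ∈ Z, xi13Term S χ ψ c' ρ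
/-- The (11.1) mean square restricted to one character and an explicit finite zero set.
[cite: Zhang2022LandauSiegel, §11 (11.1)] -/
def xi3sqSum (c' : ℝ) (Z : Finset ℂ) : ℝ := ∑ ρ ∈ Z, xi3sqTerm S χ ψ c' ρ

end Objects

/-! ## The (8.2) identity per zero, at any scale

On genuine data the zeros `ρ` lie on the critical line, where `|Z(ρ,ψχ)| = 1` for primitive `ψχ`
((2.2)), and `𝔠*(ρ,ψ)`, `ω(ρ)` are real ((2.11)–(2.12), (2.15)); under exactly these three pointwise facts the
summand of `Ξ₁` splits as in (8.2). This is the finite identity a bed checks literally, zero by zero. -/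

/-- **(8.2) per zero**: if `𝔠*(ρ,ψ)` and `ω(ρ)` are real and `|Z(ρ,ψχ)| = 1`, then
`Re 𝔠*·|H₁ + ZH̄₂|²·Re ω = Re 𝔠*·|H₁|²·Re ω + Re 𝔠*·|H₂|²·Re ω + 2Re(𝔠* Z⁻¹ H₁H₂ ω)`, i.e.
`xi1Term = xi11Term + xi12Term + 2·Re xi13Term`, at every scale. [cite: Zhang2022LandauSiegel, §8 (8.2)] -/
theorem xi1Term_eq_of_line (S : Scale) {D : ℕ} [NeZero D] (χ : DirichletCharacter ℂ D) {p : ℕ} [NeZero p]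
    (ψ : DirichletCharacter ℂ p) (c' : ℝ) (ρ : ℂ) (hc : (cstar S ψ c' ρ).im = 0)
    (hω : (omegaW S ρ).im = 0) (hZ : ‖Zpc χ ψ ρ‖ = 1) :
    xi1Term S χ ψ c' ρ = xi11Term S χ ψ c' ρ + xi12Term S χ ψ c' ρ + 2 * (xi13Term S χ ψ c' ρ).re := by
  unfold xi1Term xi11Term xi12Term xi13Term
  set c := cstar S ψ c' ρ
  set w := omegaW S ρ
  set a := H1 S χ ψ ρ
  set b := H2 S χ ψ ρ
  set Z := Zpc χ ψ ρ
  have hnZ : Z.re * Z.re + Z.im * Z.im = 1 := by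
    have h : Complex.normSq Z = 1 := by rw [Complex.normSq_eq_norm_sq, hZ, one_pow]
    rwa [Complex.normSq_apply] at h
  have hZi : Z⁻¹ = conj Z := Complex.inv_eq_conj hZ
  rw [hZi]
  simp only [Complex.sq_norm, Complex.normSq_apply, Complex.add_re, Complex.add_im, Complex.mul_re,
    Complex.mul_im, Complex.conj_re, Complex.conj_im, hc, hω]
  linear_combination (c.re * w.re * (b.re * b.re + b.im * b.im)) * hnZ


/-! ## Regression at Zhang's scale: the bed objects ARE the skeleton's -/

section Regression

variable (c' : ℝ) (D : ℕ) (χ : DirichletCharacter ℂ D) (x : Skeleton.Chr D) (s ρ : ℂ) (n : ℕ)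

/-- `α` at Zhang's scale is the skeleton's `α`. [cite: Zhang2022LandauSiegel, §2 (2.10)] -/
theorem alpha_zhang : alpha (Scale.zhang D) = Skeleton.alpha D := rfl
/-- `s₀` at Zhang's scale. [cite: Zhang2022LandauSiegel, §2 (2.8)] -/
theorem s0_zhang : s0 (Scale.zhang D) = Skeleton.s0 D := rfl
/-- `β₁` at Zhang's scale. [cite: Zhang2022LandauSiegel, §2 (2.13)] -/
theorem beta1_zhang : beta1 (Scale.zhang D) c' = Skeleton.beta1 c' D := rfl
/-- `β₂` at Zhang's scale. [cite: Zhang2022LandauSiegel, §2 (2.13)] -/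
theorem beta2_zhang : beta2 (Scale.zhang D) c' = Skeleton.beta2 c' D := rfl
/-- `β₃` at Zhang's scale. [cite: Zhang2022LandauSiegel, §2 (2.13)] -/
theorem beta3_zhang : beta3 (Scale.zhang D) c' = Skeleton.beta3 c' D := rfl
/-- `β₆` at Zhang's scale. [cite: Zhang2022LandauSiegel, §2 (2.22)] -/
theorem beta6_zhang : beta6 (Scale.zhang D) = Skeleton.beta6 D := rfl
/-- `β₇` at Zhang's scale. [cite: Zhang2022LandauSiegel, §2 (2.22)] -/
theorem beta7_zhang : beta7 (Scale.zhang D) = Skeleton.beta7 D := rfl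
/-- `ω` at Zhang's scale. [cite: Zhang2022LandauSiegel, §2 (2.15)] -/
theorem omegaW_zhang : omegaW (Scale.zhang D) s = Skeleton.omegaW D s := rfl
/-- `ϰ₁` at Zhang's scale. [cite: Zhang2022LandauSiegel, §8 (8.6)] -/
theorem vk1_zhang : vk1 (Scale.zhang D) n = Skeleton.vk1 D n := rfl
/-- `ϰ₂` at Zhang's scale. [cite: Zhang2022LandauSiegel, §8 (8.6)] -/
theorem vk2_zhang : vk2 (Scale.zhang D) n = Skeleton.vk2 D n := rfl
/-- `ϰ₃` at Zhang's scale. [cite: Zhang2022LandauSiegel, §8 (8.6)] -/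
theorem vk3_zhang : vk3 (Scale.zhang D) n = Skeleton.vk3 D n := rfl
/-- `ψχ(n)` for a member of `Ψ` is the skeleton's coefficient. [cite: Zhang2022LandauSiegel, §2 (2.23)] -/
theorem pc_zhang : pc χ x.ψ n = Skeleton.pc χ x n := rfl
/-- `H₁₁` at Zhang's scale. [cite: Zhang2022LandauSiegel, §2 (2.23)] -/
theorem H11_zhang : H11 (Scale.zhang D) χ x.ψ s = Skeleton.H11 χ x s := rfl
/-- `H₁₂` at Zhang's scale. [cite: Zhang2022LandauSiegel, §2 (2.24)] -/
theorem H12_zhang : H12 (Scale.zhang D) χ x.ψ s = Skeleton.H12 χ x s := rfl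
/-- `H₁₃` at Zhang's scale. [cite: Zhang2022LandauSiegel, §2 (2.25)] -/
theorem H13_zhang : H13 (Scale.zhang D) χ x.ψ s = Skeleton.H13 χ x s := rfl
/-- `H₁` at Zhang's scale. [cite: Zhang2022LandauSiegel, §2 (2.27)] -/
theorem H1_zhang : H1 (Scale.zhang D) χ x.ψ s = Skeleton.H1 χ x s := rfl
/-- `H₂` at Zhang's scale. [cite: Zhang2022LandauSiegel, §2 (2.27)] -/
theorem H2_zhang : H2 (Scale.zhang D) χ x.ψ s = Skeleton.H2 χ x s := rfl
/-- `J₁` at Zhang's scale. [cite: Zhang2022LandauSiegel, §2 (2.29)] -/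
theorem J1_zhang : J1 (Scale.zhang D) χ x.ψ s = Skeleton.J1 χ x s := rfl
/-- `J₂` at Zhang's scale. [cite: Zhang2022LandauSiegel, §2 (2.30)] -/
theorem J2_zhang : J2 (Scale.zhang D) χ x.ψ s = Skeleton.J2 χ x s := rfl
/-- `ψχ (mod Dp)` for a member of `Ψ` is the skeleton's. [cite: Zhang2022LandauSiegel, §4 p. 8] -/
theorem psiChi_zhang : psiChi χ x.ψ = Skeleton.psiChi χ x := rfl
variable [NeZero D] in
/-- `Z(s,ψχ)` for a member of `Ψ` is the skeleton's. [cite: Zhang2022LandauSiegel, §2 (2.2)] -/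
theorem Zpc_zhang : Zpc χ x.ψ s = Skeleton.Zpc χ x s := rfl
/-- `𝔠*(ρ,ψ)` at Zhang's scale. [cite: Zhang2022LandauSiegel, §2 p. 5] -/
theorem cstar_zhang : cstar (Scale.zhang D) x.ψ c' ρ = Skeleton.cstar c' D x ρ := rfl
/-- The zero box at Zhang's scale is `𝔷(ψ)`. [cite: Zhang2022LandauSiegel, §2 (2.14)] -/
theorem zeroBox_zhang : zeroBox (Scale.zhang D) x.ψ = Skeleton.zeroSet D x := rfl
/-- `𝔓` over the prime window is the skeleton's `𝔓`. [cite: Zhang2022LandauSiegel, §2 (2.9)] -/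
theorem frakPOf_primeWindow : frakPOf (Skeleton.primeWindow D) = frakP D :=
  (Skeleton.frakP_eq_sum_primeWindow D).symm

/-- **`Ξ₁*` is the sum of the bed summands over the skeleton's index set.** [cite: Zhang2022LandauSiegel, §2 (2.17)] -/
theorem xiStar1_eq_sum_term :
    Skeleton.xiStar1 c' χ = ∑ i ∈ Skeleton.idx χ, xiStar1Term (Scale.zhang D) χ i.1.ψ c' i.2 := rfl
variable [NeZero D] in
/-- **`Ξ₁` is the sum of the bed summands over the skeleton's index set.** [cite: Zhang2022LandauSiegel, §2 (2.32)] -/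
theorem xi1_eq_sum_term :
    Skeleton.xi1 c' χ = ∑ i ∈ Skeleton.idx χ, xi1Term (Scale.zhang D) χ i.1.ψ c' i.2 := rfl
/-- **`Ξ_J` is the sum of the bed summands.** [cite: Zhang2022LandauSiegel, §2 (2.33)] -/
theorem xiJ_eq_sum_term :
    Skeleton.xiJ c' χ = ∑ i ∈ Skeleton.idx χ, xiJTerm (Scale.zhang D) χ i.1.ψ c' i.2 := rfl
/-- **`Ξ₁₁` is the sum of the bed summands.** [cite: Zhang2022LandauSiegel, §8 (8.3)] -/
theorem xi11_eq_sum_term :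
    Skeleton.xi11 c' χ = ∑ i ∈ Skeleton.idx χ, xi11Term (Scale.zhang D) χ i.1.ψ c' i.2 := rfl
/-- **`Ξ₁₂` is the sum of the bed summands.** [cite: Zhang2022LandauSiegel, §8 (8.4)] -/
theorem xi12_eq_sum_term :
    Skeleton.xi12 c' χ = ∑ i ∈ Skeleton.idx χ, xi12Term (Scale.zhang D) χ i.1.ψ c' i.2 := rfl
variable [NeZero D] in
/-- **`Ξ₁₃` is the sum of the bed summands.** [cite: Zhang2022LandauSiegel, §8 (8.5)] -/
theorem xi13_eq_sum_term :
    Skeleton.xi13 c' χ = ∑ i ∈ Skeleton.idx χ, xi13Term (Scale.zhang D) χ i.1.ψ c' i.2 := rfl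
variable [NeZero D] in
/-- **The (11.1) mean square is the sum of the bed summands.** [cite: Zhang2022LandauSiegel, §11 (11.1)] -/
theorem xi3sq_eq_sum_term :
    Skeleton.xi3sq c' χ = ∑ i ∈ Skeleton.idx χ, xi3sqTerm (Scale.zhang D) χ i.1.ψ c' i.2 := rfl

/-- **Iterated form**: `Ξ₁₁ = Σ_{ψ ∈ Ψ₁} (Ξ₁₁ restricted to ψ and 𝔷(ψ))` — the skeleton's double sum is the
sum over the family of the per-character bed sums over the zero boxes. [cite: Zhang2022LandauSiegel, §8 (8.3)] -/
theorem xi11_eq_sum_sum :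
    Skeleton.xi11 c' χ = ∑ x ∈ Skeleton.finsetOf (Skeleton.PsiOne χ),
      xi11Sum (Scale.zhang D) χ x.ψ c' (Skeleton.finsetOf (Skeleton.zeroSet D x)) := by
  rw [xi11_eq_sum_term, Skeleton.idx, Finset.sum_sigma]
  rfl

variable [NeZero D] in
/-- Iterated form for `Ξ₁`. [cite: Zhang2022LandauSiegel, §2 (2.32)] -/
theorem xi1_eq_sum_sum :
    Skeleton.xi1 c' χ = ∑ x ∈ Skeleton.finsetOf (Skeleton.PsiOne χ),
      xi1Sum (Scale.zhang D) χ x.ψ c' (Skeleton.finsetOf (Skeleton.zeroSet D x)) := by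
  rw [xi1_eq_sum_term, Skeleton.idx, Finset.sum_sigma]
  rfl

/-- Iterated form for `Ξ_J`. [cite: Zhang2022LandauSiegel, §2 (2.33)] -/
theorem xiJ_eq_sum_sum :
    Skeleton.xiJ c' χ = ∑ x ∈ Skeleton.finsetOf (Skeleton.PsiOne χ),
      xiJSum (Scale.zhang D) χ x.ψ c' (Skeleton.finsetOf (Skeleton.zeroSet D x)) := by
  rw [xiJ_eq_sum_term, Skeleton.idx, Finset.sum_sigma]
  rfl

/-- Iterated form for `Ξ₁₂`. [cite: Zhang2022LandauSiegel, §8 (8.4)] -/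
theorem xi12_eq_sum_sum :
    Skeleton.xi12 c' χ = ∑ x ∈ Skeleton.finsetOf (Skeleton.PsiOne χ),
      xi12Sum (Scale.zhang D) χ x.ψ c' (Skeleton.finsetOf (Skeleton.zeroSet D x)) := by
  rw [xi12_eq_sum_term, Skeleton.idx, Finset.sum_sigma]
  rfl

variable [NeZero D] in
/-- Iterated form for `Ξ₁₃`. [cite: Zhang2022LandauSiegel, §8 (8.5)] -/
theorem xi13_eq_sum_sum :
    Skeleton.xi13 c' χ = ∑ x ∈ Skeleton.finsetOf (Skeleton.PsiOne χ),
      xi13Sum (Scale.zhang D) χ x.ψ c' (Skeleton.finsetOf (Skeleton.zeroSet D x)) := by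
  rw [xi13_eq_sum_term, Skeleton.idx, Finset.sum_sigma]
  rfl

/-- Iterated form for `Ξ₁*`. [cite: Zhang2022LandauSiegel, §2 (2.17)] -/
theorem xiStar1_eq_sum_sum :
    Skeleton.xiStar1 c' χ = ∑ x ∈ Skeleton.finsetOf (Skeleton.PsiOne χ),
      xiStar1Sum (Scale.zhang D) χ x.ψ c' (Skeleton.finsetOf (Skeleton.zeroSet D x)) := by
  rw [xiStar1_eq_sum_term, Skeleton.idx, Finset.sum_sigma]
  rfl

variable [NeZero D] in
/-- Iterated form for the (11.1) mean square. [cite: Zhang2022LandauSiegel, §11 (11.1)] -/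
theorem xi3sq_eq_sum_sum :
    Skeleton.xi3sq c' χ = ∑ x ∈ Skeleton.finsetOf (Skeleton.PsiOne χ),
      xi3sqSum (Scale.zhang D) χ x.ψ c' (Skeleton.finsetOf (Skeleton.zeroSet D x)) := by
  rw [xi3sq_eq_sum_term, Skeleton.idx, Finset.sum_sigma]
  rfl

end Regression

/-! ## Character-side bed quantities (Tier G1): Assumption (A) with the exponent as a parameter, and the
«(A)-exponent» of a genuine character

Assumption (A) is `‖L(1,χ)‖ < (log D)^{−2022}` (`Skeleton.AssumptionA`, exponent literal). A bed row of the
«(A)-defect ladder» (rescue/BED.md G1-01) reports, for an explicit real primitive `χ_D`, the number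
`a(D) := −log‖L(1,χ_D)‖/log log D`, and the gap table's exponent layer (G-31) asks for (A) with a general exponent.
Both get exact referents here: `AssumptionAWith A D χ` (real exponent `A`), its identification with the skeleton's
(A) at `A = 2022`, antitonicity in `A`, and the equivalence `AssumptionAWith A D χ ↔ A < aExponent D χ`
(for `log D > 1`, `L(1,χ) ≠ 0`) — so «(A) holds» reads «`aExponent > 2022`» on the bed's axis. -/

section CharacterSide

variable {D : ℕ} [NeZero D] (χ : DirichletCharacter ℂ D)

/-- **Assumption (A) with the exponent as a parameter**: `‖L(1,χ)‖ < 1/(log D)^A`, `A` real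
(`Skeleton.AssumptionA` is the case `A = 2022`). CLAIM-shape, stated not asserted.
[cite: Zhang2022LandauSiegel, §2 Assumption (A)] -/
def AssumptionAWith (A : ℝ) (D : ℕ) [NeZero D] (χ : DirichletCharacter ℂ D) : Prop :=
  ‖χ.LFunction 1‖ < 1 / Real.log D ^ A

/-- **The (A)-exponent of a character**: `aExponent D χ := −log‖L(1,χ)‖ / log log D` — the largest `A` for which
`‖L(1,χ)‖ ≤ (log D)^{−A}` (bed axis «distance of reality from the (A)-world»: (A) needs `> 2022`; for genuine
characters it is `O(1)`). [cite: Zhang2022LandauSiegel, §2 Assumption (A)] -/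
def aExponent (D : ℕ) [NeZero D] (χ : DirichletCharacter ℂ D) : ℝ :=
  -Real.log ‖χ.LFunction 1‖ / Real.log (Real.log D)

/-- The skeleton's (A) is `AssumptionAWith 2022`. [cite: Zhang2022LandauSiegel, §2 Assumption (A)] -/
theorem assumptionA_iff_with : Skeleton.AssumptionA D χ ↔ AssumptionAWith 2022 D χ := by
  unfold Skeleton.AssumptionA AssumptionAWith
  rw [show ((2022 : ℝ)) = ((2022 : ℕ) : ℝ) by norm_num, Real.rpow_natCast]

/-- **(A) is antitone in its exponent** once `log D ≥ 1`: a larger exponent is a stronger assumption,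
`A ≤ A′ → AssumptionAWith A′ D χ → AssumptionAWith A D χ`. [cite: Zhang2022LandauSiegel, §2 Assumption (A)] -/
theorem assumptionAWith_anti {A A' : ℝ} (hD : 1 ≤ Real.log D) (hAA' : A ≤ A') (h : AssumptionAWith A' D χ) :
    AssumptionAWith A D χ := by
  unfold AssumptionAWith at h ⊢
  refine lt_of_lt_of_le h (one_div_le_one_div_of_le (Real.rpow_pos_of_pos (by linarith) _) ?_)
  exact Real.rpow_le_rpow_of_exponent_le hD hAA'

/-- **(A) at exponent `A` on the bed's axis**: for `log D > 1` and `L(1,χ) ≠ 0`,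
`AssumptionAWith A D χ ↔ A < aExponent D χ` (`‖L(1,χ)‖ < (log D)^{−A} ⟺ log‖L(1,χ)‖ < −A·log log D`).
[cite: Zhang2022LandauSiegel, §2 Assumption (A)] -/
theorem assumptionAWith_iff_lt_aExponent {A : ℝ} (hD : 1 < Real.log D) (hL : χ.LFunction 1 ≠ 0) :
    AssumptionAWith A D χ ↔ A < aExponent D χ := by
  unfold AssumptionAWith aExponent
  have hlogD : 0 < Real.log D := by linarith
  have hll : 0 < Real.log (Real.log D) := Real.log_pos hD
  have hnorm : 0 < ‖χ.LFunction 1‖ := norm_pos_iff.mpr hL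
  have hpow : 0 < Real.log D ^ A := Real.rpow_pos_of_pos hlogD A
  rw [lt_div_iff₀ hll, one_div, ← Real.log_lt_log_iff hnorm (inv_pos.mpr hpow), Real.log_inv,
    Real.log_rpow hlogD]
  constructor <;> intro h <;> linarith

/-- In particular the skeleton's (A) reads `2022 < aExponent D χ` (for `log D > 1`, `L(1,χ) ≠ 0`).
[cite: Zhang2022LandauSiegel, §2 Assumption (A)] -/
theorem assumptionA_iff_lt_aExponent (hD : 1 < Real.log D) (hL : χ.LFunction 1 ≠ 0) :
    Skeleton.AssumptionA D χ ↔ 2022 < aExponent D χ := by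
  rw [assumptionA_iff_with, assumptionAWith_iff_lt_aExponent χ hD hL]

end CharacterSide

end Literature.NumberTheory.LFunctions.Zhang2022.Repair.Bed
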